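import Summits.MatrixMultiplication.MatrixMultiplication.Theses.ThinBlockAlpha
import Summits.MatrixMultiplication.MatrixMultiplication.Theorems.BoundedExponentThird.Negative.TwoLegBound

/-!
# Candidate proof of STUB 4 `stub_symmetrise` of line `tame-charts` (refuter drefute seat; evidence for the lead)

`AsymDesignAt ℓ η → DesignAt ℓ (2η)` by the reversal `(A,B,C) ↦ (−C,−B,−A)` and the product in `H × H`, reindexed by
`finProdFinEquiv`.  `AsymDesignAt` is a VERBATIM copy of the skeleton's; `DesignAt` is the landed one
(`Negative.TwoLegBound`).  The proof of `symmetrise_proof` transplants textually into `Lines/tame-charts.lean`.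
-/

set_option linter.dupNamespace false

namespace Summit.MatrixMultiplication.MatrixMultiplication.Cruxes.BoundedExponentThird.TameChartsStub4

open Finset Literature.Computability.AlgebraicComplexity
open Summit.MatrixMultiplication.MatrixMultiplication.Theorems.BoundedExponentThird.Negative (DesignAt)

/-- verbatim copy of `TameCharts.AsymDesignAt`. -/
def AsymDesignAt (ℓ : ℕ) (η : ℝ) : Prop :=
  ∃ (H : Type) (_ : AddCommGroup H) (_ : Fintype H) (L N₁ M N₂ : ℕ) (A B C : Fin L → Finset H),
    AddMonoid.exponent H ≤ ℓ ∧ IsSTPP A B C ∧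
    (∀ i, (A i).card = N₁ ∧ (B i).card = M ∧ (C i).card = N₂) ∧ 2 ≤ N₁ * N₂ ∧
    ((N₁ * N₂ : ℕ) : ℝ) ^ (1 / 3 : ℝ) ≤ (M : ℝ) ^ 2 ∧
    (Fintype.card H : ℝ) ≤ L * ((N₁ * N₂ : ℕ) : ℝ) ^ (1 + η)

/-- Negation of a finset along the `Equiv.neg` embedding (no `DecidableEq` needed). -/
def negF {H : Type} [AddCommGroup H] (S : Finset H) : Finset H := S.map (Equiv.neg H).toEmbedding

theorem mem_negF {H : Type} [AddCommGroup H] {S : Finset H} {x : H} : x ∈ negF S ↔ -x ∈ S := by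
  unfold negF
  rw [Finset.mem_map_equiv]
  rfl

theorem card_negF {H : Type} [AddCommGroup H] (S : Finset H) : (negF S).card = S.card :=
  Finset.card_map _

/-- **Reversal × product is STPP**: blocks `(A i ×ˢ (−C j), B i ×ˢ (−B j), C i ×ˢ (−A j))` on `Fin L × Fin L`. -/
theorem isSTPP_symm {H : Type} [AddCommGroup H] {L : ℕ} {A B C : Fin L → Finset H} (h : IsSTPP A B C)
    (e : Fin (L * L) ≃ Fin L × Fin L) :
    IsSTPP (fun p => A (e p).1 ×ˢ negF (C (e p).2)) (fun p => B (e p).1 ×ˢ negF (B (e p).2))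
      (fun p => C (e p).1 ×ˢ negF (A (e p).2)) := by
  intro p q r s hs s' hs' t ht t' ht' u hu u' hu' h0
  simp only [Finset.mem_product, mem_negF] at hs hs' ht ht' hu hu'
  have h1 : (s'.1 - s.1) + (t'.1 - t.1) + (u'.1 - u.1) = 0 := by
    have := congrArg Prod.fst h0; simpa using this
  have h2 : (s'.2 - s.2) + (t'.2 - t.2) + (u'.2 - u.2) = 0 := by
    have := congrArg Prod.snd h0; simpa using this
  -- first coordinates: the original STPP at indices ((e p).1, (e q).1, (e r).1)
  obtain ⟨hpq1, hqr1, hss1, htt1, huu1⟩ :=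
    h (e p).1 (e q).1 (e r).1 s.1 hs.1 s'.1 hs'.1 t.1 ht.1 t'.1 ht'.1 u.1 hu.1 u'.1 hu'.1 h1
  -- second coordinates: the original STPP at indices ((e q).2, (e p).2, (e r).2) with reversed roles
  have h2' : (-u.2 - -u'.2) + (-t.2 - -t'.2) + (-s.2 - -s'.2) = 0 := by
    rw [← h2]; abel
  obtain ⟨hqp2, hpr2, huu2, htt2, hss2⟩ :=
    h (e q).2 (e p).2 (e r).2 (-u'.2) hu'.2 (-u.2) hu.2 (-t'.2) ht'.2 (-t.2) ht.2 (-s'.2) hs'.2 (-s.2) hs.2 h2'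
  have hpq : p = q := e.injective (Prod.ext hpq1 hqp2.symm)
  have hqr : q = r := e.injective (Prod.ext hqr1 (hqp2.trans hpr2))
  refine ⟨hpq, hqr, Prod.ext hss1 ?_, Prod.ext htt1 ?_, Prod.ext huu1 ?_⟩
  · have := neg_inj.mp hss2; exact this.symm
  · have := neg_inj.mp htt2; exact this.symm
  · have := neg_inj.mp huu2; exact this.symm

/-- **STUB 4** (`Symmetrise` verbatim). -/
theorem symmetrise_proof : ∀ (ℓ : ℕ) (η : ℝ), AsymDesignAt ℓ η → DesignAt ℓ (2 * η) := by
  intro ℓ η hA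
  obtain ⟨H, instH, finH, L, N₁, M, N₂, A, B, C, hexp, hS, hcard, h2, hthin, hpack⟩ := hA
  let e : Fin (L * L) ≃ Fin L × Fin L := finProdFinEquiv.symm
  refine ⟨H × H, inferInstance, inferInstance, L * L, N₁ * N₂, M * M,
    fun p => A (e p).1 ×ˢ negF (C (e p).2), fun p => B (e p).1 ×ˢ negF (B (e p).2),
    fun p => C (e p).1 ×ˢ negF (A (e p).2), ?_, isSTPP_symm hS e, ?_, h2, ?_, ?_⟩
  · -- exponent of H × H
    rw [AddMonoid.exponent_prod, lcm_same, normalize_eq]; exact hexp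
  · intro p
    refine ⟨?_, ?_, ?_⟩
    · rw [Finset.card_product, card_negF, (hcard _).1, (hcard _).2.2]
    · rw [Finset.card_product, card_negF, (hcard _).2.1, (hcard _).2.1]
    · rw [Finset.card_product, card_negF, (hcard _).2.2, (hcard _).1, Nat.mul_comm]
  · -- thinness: (N₁N₂)^{1/3} ≤ M² = ((M*M : ℕ) : ℝ)
    have : ((M * M : ℕ) : ℝ) = (M : ℝ) ^ 2 := by push_cast; ring
    rw [this]; exact hthin
  · -- packing: |H × H| = |H|² ≤ (L·L)·(N₁N₂)^{2+2η}
    have hX : (0 : ℝ) < ((N₁ * N₂ : ℕ) : ℝ) := by exact_mod_cast (by omega : 0 < N₁ * N₂)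
    have hL : (0 : ℝ) ≤ (L : ℝ) * ((N₁ * N₂ : ℕ) : ℝ) ^ (1 + η) := by positivity
    have hH : (0 : ℝ) ≤ (Fintype.card H : ℝ) := Nat.cast_nonneg _
    have key := mul_le_mul hpack hpack hH hL
    rw [Fintype.card_prod, Nat.cast_mul (Fintype.card H) (Fintype.card H),
      show ((L * L : ℕ) : ℝ) = (L : ℝ) * (L : ℝ) by push_cast; ring]
    calc (Fintype.card H : ℝ) * (Fintype.card H : ℝ)
        ≤ ((L : ℝ) * ((N₁ * N₂ : ℕ) : ℝ) ^ (1 + η)) * ((L : ℝ) * ((N₁ * N₂ : ℕ) : ℝ) ^ (1 + η)) := key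
      _ = ((L : ℝ) * (L : ℝ)) * (((N₁ * N₂ : ℕ) : ℝ) ^ (1 + η) * ((N₁ * N₂ : ℕ) : ℝ) ^ (1 + η)) := by ring
      _ = ((L : ℝ) * (L : ℝ)) * ((N₁ * N₂ : ℕ) : ℝ) ^ (2 + 2 * η) := by
          rw [← Real.rpow_add hX]; congr 1; congr 1; ring

end Summit.MatrixMultiplication.MatrixMultiplication.Cruxes.BoundedExponentThird.TameChartsStub4
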